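import Summits.PneNP.PneNP.Theorems.Capture.Negative.LoadBearing
import Summits.PneNP.PneNP.Theorems.ConvexRankGatesCaptureTJoinSpan
import HarnessLib.Audit

/-!
# Strategy census r1 (redirect strategist, second opinion) for the crux `Capture` (stmt-PneNP-2659) — typed companions

Companion file of `Cruxes/Capture/STRATEGY-CENSUS.md` (part r1, planner-cstrat-stmt-PneNP-2659-r1-0, 2026-08-17).
Everything here is `sorry`-free.  It records, as Lean objects over tree declarations:

* §1 `IsLevelGenerated`, `CaptureHom`, the PROVED `closesHom : CaptureHom → CliqueExtLowerBound → CliqueBridge →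
  PneNP` (the route's deciding theorem needs the crux only at the clique function, which is level-generated =
  homogeneous, `cliqueFn_isLevelGenerated`, level `C(k,2)`) — AND the reason this apparent weakening is INERT:
  double-rail padding `railPad f (x,y) = f x ∧ ⋀ᵢ (xᵢ ∨ yᵢ)` makes EVERY monotone function level-generated of level
  `n` (`isLevelGenerated_railPad`) at cost `O(n)` gates, and `railPad f (x, 1) = f x` (`railPad_inl_one`), so
  `CaptureHom ↔ Capture` (→ : pad, capture, plug `y := 1`, constants being CONV gates; ← : `captureHom_of_capture`).
  Recorded so that nobody re-files "restrict the crux to homogeneous functions / all third doors on record are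
  inhomogeneous" as a re-target: it is the crux in costume (STRENGTHEN/DECOMPOSITION headings of the census).
* §2 `oddFactor_isGRankGate` — the Grigni–Sipser candidate of Cavalar–Oliveira (CCC 2023, §1.2:
  `OddFactor_n`, "every connected component has an even number of vertices", in `L`, monotone depth
  `n^{Ω(1)}`) is ONE GRANK gate: it is `T`-join existence with `T = V`, i.e. the tree theorem
  `graphicSpan_isGRankGate` (lead c8) at the all-ones terminal vector.
* §3 typed forms used under the census headings: `CaptureACDepth` (the depth ladder's rungs, TRANSFER /
  STRENGTHEN), `BPCapture` with `bpCapture_of_capture` (randomised normal form, DECOMPOSITION/NEGATION),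
  `LevelCapture` (the OR-decomposition of the seam; too strong — TRIAGE-r1-1 App. B).

Nothing here is a proof of, or evidence against, `Capture` as typed.
-/

set_option linter.dupNamespace false

namespace Summit.PneNP.PneNP.Cruxes.Capture.StrategistR1

open Literature.Computability.Complexity
open Summit.PneNP.PneNP.Theses.ConvexRankGates (Capture CliqueExtLowerBound CliqueBridge)
open Summit.PneNP.PneNP.Theorems.Capture.Negative (CaptureInto capture_iff inlineExt_eq_extGate)
open scoped Classical

/-! ## §1 The route needs only the LEVEL-GENERATED case of the crux -/

/-- Hamming weight of a Boolean point of a finite cube. -/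
def weight {ι : Type} [Fintype ι] (x : ι → Bool) : ℕ :=
  (Finset.univ.filter fun i => x i = true).card

/-- A Boolean function is **level-generated** (homogeneous) if for one level `K` it is the up-closure of its
true points of weight exactly `K`: `f x ↔ ∃ y ≤ x, f y ∧ |y| = K`.  For monotone `f` this says that every
minimal true point (minterm) has weight `K`.  Examples: `CLIQUE(m,k)` (`K = C(k,2)`), perfect matching,
spanning trees, bases / common bases of matroids; NON-examples: XOR-SAT, LIN-UNSAT over `ℤ/2^k`, OddFactor,
2-LINKAGE (minimal witnesses of several sizes). [folklore] -/
def IsLevelGenerated {ι : Type} [Fintype ι] (f : (ι → Bool) → Bool) : Prop :=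
  ∃ K : ℕ, ∀ x, f x = true ↔ ∃ y, y ≤ x ∧ f y = true ∧ weight y = K

/-- `CaptureHom` with an arbitrary target basis family (shape of `CaptureInto`). -/
def CaptureHomInto (B : ℕ → Set GateFn) : Prop :=
  ∃ a : ℕ, ∀ (ι : Type) (_ : Fintype ι) (f : (ι → Bool) → Bool), Monotone f → IsLevelGenerated f →
    ∀ C : Circuit ι, C.IsOver B2 → C.Computes f →
      ∃ C' : Circuit ι, C'.IsOver (B ((C.size + Fintype.card ι + 2) ^ a)) ∧
        C'.size ≤ (C.size + Fintype.card ι + 2) ^ a ∧ C'.Computes f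

/-- **`CaptureHom`: the crux `Capture` restricted to level-generated monotone functions.**  Every MONOTONE,
LEVEL-GENERATED Boolean function with a `B₂`-circuit of size `t` on `n` inputs has a circuit with at most
`N = (t+n+2)^a` gates over the extended monotone basis `B_N = {∧₂,∨₂} ∪ CONV_N ∪ PERM_N ∪ GRANK_N`.
Sufficient for the route (`closesHom`) — but EQUIVALENT to `Capture`: `Capture → CaptureHom` is
`captureHom_of_capture`, and conversely every monotone `f` is the `y := 1` restriction of the level-generated
`railPad f` (`isLevelGenerated_railPad`, `railPad_inl_one`), whose `B₂`-size is `t + O(n)`.  A costume, kept as a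
record. -/
def CaptureHom : Prop := CaptureHomInto extGate

/-- `Capture → CaptureHom` (drop the extra hypothesis). -/
theorem captureHom_of_capture (h : Capture) : CaptureHom := by
  rw [capture_iff] at h
  obtain ⟨a, h⟩ := h
  exact ⟨a, fun ι _ f hf _ C hB hC => h ι _ f hf C hB hC⟩

section RailPad

variable {ι : Type} [Fintype ι]

/-- **Double-rail padding.** `railPad f (x, y) = f x ∧ ⋀ᵢ (xᵢ ∨ yᵢ)` on the doubled variable set `ι ⊕ ι`
(`x` on the left summand, the "positive copies of the negated variables" `y` on the right). [folklore] -/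
def railPad (f : (ι → Bool) → Bool) : (ι ⊕ ι → Bool) → Bool :=
  fun z => f (fun i => z (Sum.inl i)) && decide (∀ i, z (Sum.inl i) = true ∨ z (Sum.inr i) = true)

theorem railPad_monotone {f : (ι → Bool) → Bool} (hf : Monotone f) : Monotone (railPad f) := by
  intro z z' hzz'
  apply Bool.le_iff_imp.2
  simp only [railPad, Bool.and_eq_true, decide_eq_true_eq]
  rintro ⟨hfz, hcov⟩
  refine ⟨?_, fun i => ?_⟩
  · have hle : (fun i => z (Sum.inl i)) ≤ fun i => z' (Sum.inl i) := fun i => hzz' (Sum.inl i)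
    have := hf hle
    rw [hfz] at this
    exact top_le_iff.1 this
  · rcases hcov i with h | h
    · left
      have := hzz' (Sum.inl i); rw [h] at this; exact top_le_iff.1 this
    · right
      have := hzz' (Sum.inr i); rw [h] at this; exact top_le_iff.1 this

/-- Plugging `y := 1` recovers `f`: `railPad f (x, 1) = f x`. [folklore] -/
theorem railPad_inl_one (f : (ι → Bool) → Bool) (x : ι → Bool) :
    railPad f (Sum.elim x fun _ => true) = f x := by
  simp [railPad]

/-- The consistent double rail `(x, x̄)` of `x`. -/
def rails (x : ι → Bool) : ι ⊕ ι → Bool := Sum.elim x fun i => !x i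

theorem weight_rails (x : ι → Bool) : weight (rails x) = Fintype.card ι := by
  unfold weight
  rw [Finset.card_filter, Fintype.sum_sum_type, ← Finset.sum_add_distrib, Finset.card_univ.symm,
    Finset.card_eq_sum_ones]
  refine Finset.sum_congr rfl fun i _ => ?_
  cases h : x i <;> simp [rails, h]

/-- **Every monotone function becomes level-generated (of level `n = |ι|`) after double-rail padding**: the
minimal true points of `railPad f` are exactly the consistent rails `(x, x̄)` with `f x = 1`, all of weight `n`.
Hence "restrict `Capture` to homogeneous functions" is no weakening. [folklore] -/
theorem isLevelGenerated_railPad {f : (ι → Bool) → Bool} (hf : Monotone f) : IsLevelGenerated (railPad f) := by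
  refine ⟨Fintype.card ι, fun z => ⟨fun hz => ?_, ?_⟩⟩
  · simp only [railPad, Bool.and_eq_true, decide_eq_true_eq] at hz
    obtain ⟨hfz, hcov⟩ := hz
    refine ⟨rails fun i => z (Sum.inl i), ?_, ?_, weight_rails _⟩
    · rintro (i | i)
      · exact le_rfl
      · simp only [rails, Sum.elim_inr]
        rcases hcov i with h | h
        · simp [h]
        · simp [h]
    · simp only [railPad, rails, Sum.elim_inl, Sum.elim_inr, Bool.and_eq_true, decide_eq_true_eq]
      exact ⟨hfz, fun i => by cases z (Sum.inl i) <;> simp⟩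
  · rintro ⟨z', hz'z, hz', -⟩
    have := railPad_monotone hf hz'z
    rw [hz'] at this
    exact top_le_iff.1 this

end RailPad

section Clique

variable {m : ℕ}

/-- An unordered pair is an edge of the complete graph iff it is not a loop. [folklore] -/
theorem mem_edgeSet_top_iff {V : Type} (z : Sym2 V) : z ∈ (⊤ : SimpleGraph V).edgeSet ↔ ¬ z.IsDiag := by
  induction z using Sym2.ind with
  | h a b => simp [Sym2.mk_isDiag_iff]

/-- The edge-indicator vector of a vertex set `S` (the "clique vector" of the route's support items). -/
def cliqueVec (S : Finset (Fin m)) : (⊤ : SimpleGraph (Fin m)).edgeSet → Bool :=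
  fun e => decide (∀ v ∈ (e : Sym2 (Fin m)), v ∈ S)

/-- **The clique vector of `S` has Hamming weight `C(|S|, 2)`.** [folklore] -/
theorem weight_cliqueVec (S : Finset (Fin m)) : weight (cliqueVec S) = S.card.choose 2 := by
  classical
  unfold weight
  rw [← Sym2.card_image_offDiag S, ← Finset.card_map (Function.Embedding.subtype _)]
  congr 1
  have hS : S.offDiag.image Sym2.mk.uncurry = {x ∈ S.sym2 | ¬ x.IsDiag} := by
    rw [Finset.sym2_eq_image, Sym2.filter_image_mk_not_isDiag]
  rw [hS]
  ext z
  simp only [Finset.mem_map, Finset.mem_filter, Finset.mem_univ, true_and, Function.Embedding.coe_subtype,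
    Finset.mem_sym2_iff, cliqueVec, decide_eq_true_eq]
  constructor
  · rintro ⟨e, he, rfl⟩
    exact ⟨he, (mem_edgeSet_top_iff (e : Sym2 (Fin m))).1 e.2⟩
  · rintro ⟨hz, hd⟩
    exact ⟨⟨z, (mem_edgeSet_top_iff z).2 hd⟩, hz, rfl⟩

/-- The graph spanned by an edge-selection vector `x`. -/
def graphOf (x : (⊤ : SimpleGraph (Fin m)).edgeSet → Bool) : SimpleGraph (Fin m) :=
  SimpleGraph.fromEdgeSet {e : Sym2 (Fin m) | ∃ h : e ∈ (⊤ : SimpleGraph (Fin m)).edgeSet, x ⟨e, h⟩ = true}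

theorem graphOf_adj {x : (⊤ : SimpleGraph (Fin m)).edgeSet → Bool} {u v : Fin m} :
    (graphOf x).Adj u v ↔ ∃ h : s(u, v) ∈ (⊤ : SimpleGraph (Fin m)).edgeSet, x ⟨s(u, v), h⟩ = true := by
  unfold graphOf
  rw [SimpleGraph.fromEdgeSet_adj]
  constructor
  · rintro ⟨⟨h, hx⟩, -⟩
    exact ⟨h, hx⟩
  · rintro ⟨h, hx⟩
    refine ⟨⟨h, hx⟩, ?_⟩
    have := (mem_edgeSet_top_iff (s(u, v))).1 h
    rwa [Sym2.mk_isDiag_iff] at this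

theorem graphOf_mono {x y : (⊤ : SimpleGraph (Fin m)).edgeSet → Bool} (hxy : x ≤ y) : graphOf x ≤ graphOf y := by
  intro u v huv
  rw [graphOf_adj] at huv ⊢
  obtain ⟨h, hx⟩ := huv
  refine ⟨h, ?_⟩
  have hle := hxy ⟨s(u, v), h⟩
  rw [hx] at hle
  exact top_le_iff.1 hle

/-- The route's clique function (written inline exactly as in `CliqueExtLowerBound` / `closes`). -/
noncomputable def cliqueFn (m k : ℕ) : ((⊤ : SimpleGraph (Fin m)).edgeSet → Bool) → Bool :=
  fun x => decide (¬ (graphOf x).CliqueFree k)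

theorem cliqueFn_monotone (m k : ℕ) : Monotone (cliqueFn m k) := by
  intro x y hxy
  apply Bool.le_iff_imp.2
  simp only [cliqueFn, decide_eq_true_eq]
  intro hx hy
  exact hx (hy.anti (graphOf_mono hxy))

/-- `S` is a clique of the graph of its own clique vector. -/
theorem isClique_graphOf_cliqueVec (S : Finset (Fin m)) : (graphOf (cliqueVec S)).IsClique (S : Set (Fin m)) := by
  intro u hu v hv huv
  rw [graphOf_adj]
  refine ⟨(mem_edgeSet_top_iff _).2 (by rwa [Sym2.mk_isDiag_iff]), ?_⟩
  simp only [cliqueVec, decide_eq_true_eq]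
  intro w hw
  rcases Sym2.mem_iff.1 hw with rfl | rfl
  · exact hu
  · exact hv

/-- The clique vector of a clique `S` of `graphOf x` lies below `x`. -/
theorem cliqueVec_le_of_isClique {x : (⊤ : SimpleGraph (Fin m)).edgeSet → Bool} {S : Finset (Fin m)}
    (hS : (graphOf x).IsClique (S : Set (Fin m))) : cliqueVec S ≤ x := by
  intro e
  rcases e with ⟨z, hz⟩
  induction z using Sym2.ind with
  | h u v =>
    apply Bool.le_iff_imp.2
    simp only [cliqueVec, decide_eq_true_eq]
    intro hmem
    have hu : u ∈ S := hmem u (Sym2.mem_mk_left u v)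
    have hv : v ∈ S := hmem v (Sym2.mem_mk_right u v)
    have huv : u ≠ v := by
      have := (mem_edgeSet_top_iff (s(u, v))).1 hz
      rwa [Sym2.mk_isDiag_iff] at this
    obtain ⟨h, hx⟩ := (graphOf_adj).1 (hS hu hv huv)
    exact hx

/-- **The clique function is level-generated, of level `C(k,2)`**: a graph contains a `k`-clique iff it
contains the edge set of a `k`-clique, which has exactly `C(k,2)` edges. [folklore] -/
theorem cliqueFn_isLevelGenerated (m k : ℕ) : IsLevelGenerated (cliqueFn m k) := by
  refine ⟨k.choose 2, fun x => ⟨fun hx => ?_, ?_⟩⟩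
  · have hx' : ¬ (graphOf x).CliqueFree k := by simpa [cliqueFn] using hx
    simp only [SimpleGraph.CliqueFree, not_forall, not_not] at hx'
    obtain ⟨S, hS⟩ := hx'
    refine ⟨cliqueVec S, cliqueVec_le_of_isClique hS.1, ?_, ?_⟩
    · have : ¬ (graphOf (cliqueVec S)).CliqueFree k := fun h => h S ⟨isClique_graphOf_cliqueVec S, hS.2⟩
      simpa [cliqueFn] using this
    · rw [weight_cliqueVec, hS.2]
  · rintro ⟨y, hyx, hy, -⟩
    have := cliqueFn_monotone m k hyx
    rw [hy] at this
    exact top_le_iff.1 this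

end Clique

/-- **The route's deciding theorem with the weakened crux.**  `CaptureHom → CliqueExtLowerBound →
CliqueBridge → PneNP`: verbatim the route's `closes` (Theses/ConvexRankGates.lean, 45 lines), except that
the simulation hypothesis is invoked only at the clique function, which is level-generated
(`cliqueFn_isLevelGenerated`).  So crux #3 can be RESTATED as `CaptureHom` without touching #5 or the
bridge. [folklore] -/
theorem closesHom (hCap : CaptureHom) (hLB : CliqueExtLowerBound) (hBridge : CliqueBridge) : PneNP := by
  apply hBridge
  obtain ⟨δ, hδ0, hδ1, hlb⟩ := hLB
  obtain ⟨a, hcap⟩ := hCap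
  refine ⟨δ, hδ0, hδ1, fun c => ?_⟩
  filter_upwards [hlb ((c + 3) * a), Filter.eventually_ge_atTop 3] with m hm h3 C hB2 hsize hcomp
  -- CaptureHom: simulate the B2-circuit of the (level-generated) clique function by an extended-basis circuit
  obtain ⟨C', hC'over, hC'size, hC'comp⟩ :=
    hcap _ inferInstance (cliqueFn m ⌈(m : ℝ) ^ δ⌉₊) (cliqueFn_monotone m _) (cliqueFn_isLevelGenerated m _)
      C hB2 hcomp
  -- size bookkeeping: (C.size + #E(K_m) + 2) ^ a ≤ m ^ ((c + 3) * a) for m ≥ 3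
  have h1 : 1 ≤ m := le_trans (by norm_num) h3
  have hcard : Fintype.card ((⊤ : SimpleGraph (Fin m)).edgeSet) ≤ m ^ (c + 2) := by
    calc Fintype.card ((⊤ : SimpleGraph (Fin m)).edgeSet)
        ≤ Fintype.card (Sym2 (Fin m)) := Fintype.card_le_of_injective Subtype.val Subtype.val_injective
      _ ≤ Fintype.card (Fin m × Fin m) :=
          Fintype.card_le_of_surjective (Sym2.mk (α := Fin m)).uncurry (fun z => by
            induction z using Sym2.ind with
            | h a b => exact ⟨(a, b), rfl⟩)
      _ = m ^ 2 := by simp [sq]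
      _ ≤ m ^ (c + 2) := Nat.pow_le_pow_right h1 (by omega)
  have hsz : C.size ≤ m ^ (c + 2) := hsize.trans (Nat.pow_le_pow_right h1 (by omega))
  have htwo : 2 ≤ m ^ (c + 2) := by
    calc 2 ≤ m := by omega
      _ = m ^ 1 := (pow_one m).symm
      _ ≤ m ^ (c + 2) := Nat.pow_le_pow_right h1 (by omega)
  have hN : C.size + Fintype.card ((⊤ : SimpleGraph (Fin m)).edgeSet) + 2 ≤ m ^ (c + 3) := by
    calc C.size + Fintype.card ((⊤ : SimpleGraph (Fin m)).edgeSet) + 2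
        ≤ m ^ (c + 2) + m ^ (c + 2) + m ^ (c + 2) := by omega
      _ = 3 * m ^ (c + 2) := by ring
      _ ≤ m * m ^ (c + 2) := Nat.mul_le_mul_right _ h3
      _ = m ^ (c + 3) := by ring
  have hbound : (C.size + Fintype.card ((⊤ : SimpleGraph (Fin m)).edgeSet) + 2) ^ a ≤ m ^ ((c + 3) * a) := by
    rw [pow_mul]
    exact Nat.pow_le_pow_left hN a
  -- the extended gate classes grow with the size parameter, so C' is a B_{m^c'}-circuit: contradiction
  refine hm C' (fun g hg => ?_) (hC'size.trans hbound) hC'comp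
  have hgm : g.fn ∈ extGate (m ^ ((c + 3) * a)) := extGate_mono hbound (hC'over g hg)
  rw [← inlineExt_eq_extGate] at hgm
  exact hgm

/-! ## §2 Cavalar–Oliveira's `OddFactor` is ONE GRANK gate -/

/-- **`OddFactor` is one GRANK gate.**  For a fixed edge list `(p i, q i)` on a vertex type `V`, the monotone
function "the selected edges admit a spanning subgraph in which every vertex has odd degree" — in the
Tseitin / linear-algebra form of Cavalar–Oliveira (CCC 2023, §1.2): `𝟙_V ∈ span_{𝔽₂} {e_{p i} + e_{q i} :
i selected}` (equivalently: every connected component of the selected graph has an even number of vertices)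
— is a generic-rank threshold gate of dimension `|V|(|V|+1)|V| + |V|`.  It is `graphicSpan_isGRankGate`
(lead c8, `T`-join existence) with ALL vertices as terminals.  So the function proposed there for the
Grigni–Sipser question (`AC⁰ ∩ Mono ⊄ mSIZE[poly]`?), which has monotone DEPTH `n^{Ω(1)}` (Babai–Gál–
Wigderson 1999), is inside the route's basis as a single gate. [cite: CavalarOliveira2023, §1.2] -/
theorem oddFactor_isGRankGate (V : Type) [Fintype V] [DecidableEq V] (n : ℕ) (p q : Fin n → V)
    (f : (Fin n → Bool) → Bool)
    (hf : ∀ v, f v = true ↔ (fun _ => (1 : ZMod 2) : V → ZMod 2) ∈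
      Submodule.span (ZMod 2) ((fun i => (Pi.single (p i) (1 : ZMod 2) + Pi.single (q i) 1 : V → ZMod 2)) ''
        {i | v i = true})) :
    IsGRankGate ((Fintype.card V * (Fintype.card V + 1)) * Fintype.card V + Fintype.card V) ⟨n, f⟩ := by
  classical
  -- the all-ones vector is the sum of the unit vectors over an enumeration of `V`
  have hone : (fun _ => (1 : ZMod 2) : V → ZMod 2) =
      ∑ j : Fin (Fintype.card V), (Pi.single ((Fintype.equivFin V).symm j) (1 : ZMod 2) : V → ZMod 2) := by
    ext u
    rw [Finset.sum_apply]
    rw [Finset.sum_eq_single (Fintype.equivFin V u)]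
    · simp
    · intro j _ hj
      rw [Pi.single_apply, if_neg]
      intro hu
      exact hj (by rw [hu, Equiv.apply_symm_apply])
    · intro h
      exact absurd (Finset.mem_univ _) h
  refine Summit.PneNP.PneNP.Theorems.Capture.TJoin.graphicSpan_isGRankGate V n (Fintype.card V) p q
    (fun j => (Fintype.equivFin V).symm j) f fun v => ?_
  rw [hf v, hone]

/-! ## §3 Typed forms used in the census -/

/-- The unbounded fan-in AND/OR/NOT basis of `AC⁰`. -/
def acGate : Set GateFn := {g | (∃ k, g = GateFn.and k) ∨ (∃ k, g = GateFn.or k) ∨ g = GateFn.not}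

/-- **The depth ladder (TRANSFER/STRENGTHEN headings).**  `CaptureACDepth d`: capture for monotone functions
computed by depth-`d` unbounded fan-in circuits, budget polynomial in the number of WIRES `W = Σ fan-ins`
(so that the `B₂`-conversion is polynomial) — a special case of `Capture` for every fixed `d`.  Its
PLAIN-monotone analogue `AC⁰_d ∩ Mono ⊆ mSIZE[poly]` is open from `d = 3` and breakthrough-equivalent
(Cavalar–Oliveira 2023, Thm 1.3: `d = 4` gives `NP ⊄ AC⁰₄[2^{o(√n/log n)}]`, all `d` give `NC² ⊄ NC¹`);
the extended-basis version has no such consequence because no extended-basis lower bound exists.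
[cite: CavalarOliveira2023, Thm 1.3] -/
def CaptureACDepth (d : ℕ) : Prop :=
  ∃ a : ℕ, ∀ (ι : Type) (_ : Fintype ι) (f : (ι → Bool) → Bool), Monotone f →
    ∀ C : Circuit ι, C.IsOver acGate → C.depth ≤ d → C.Computes f →
      ∃ C' : Circuit ι, C'.IsOver (extGate ((C.sizeWith Sigma.fst + C.size + Fintype.card ι + 2) ^ a)) ∧
        C'.size ≤ (C.sizeWith Sigma.fst + C.size + Fintype.card ι + 2) ^ a ∧ C'.Computes f

/-- **Randomised normal form (DECOMPOSITION/NEGATION headings).**  `BPCapture`: every monotone `f` with a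
`B₂`-circuit of size `t` has a FAMILY of `2^r` extended-monotone circuits of size `≤ N = (t+n+2)^a` (one per
seed) such that on every input fewer than a third of the seeds err.  `Capture → BPCapture` with `r = 0`
(`bpCapture_of_capture`); conversely (paper: Adleman's union bound over `O(n)` independent seeds + one
majority gate, which is a CONV₁ gate, `maj_isConvGate`) `BPCapture → Capture` — randomness is inert here:
each member of the family is itself a monotone extended circuit. [folklore] -/
def BPCapture : Prop :=
  ∃ a : ℕ, ∀ (ι : Type) (_ : Fintype ι) (f : (ι → Bool) → Bool), Monotone f →
    ∀ C : Circuit ι, C.IsOver B2 → C.Computes f →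
      ∃ (r : ℕ) (C' : (Fin r → Bool) → Circuit ι),
        (∀ ρ, (C' ρ).IsOver (extGate ((C.size + Fintype.card ι + 2) ^ a)) ∧
          (C' ρ).size ≤ (C.size + Fintype.card ι + 2) ^ a) ∧
        ∀ x, 3 * (Finset.univ.filter fun ρ => (C' ρ).eval x ≠ f x).card < 2 ^ r

/-- The deterministic statement is the seedless case of the randomised one. -/
theorem bpCapture_of_capture (h : Capture) : BPCapture := by
  rw [capture_iff] at h
  obtain ⟨a, h⟩ := h
  refine ⟨a, fun ι _ f hf C hB hC => ?_⟩
  obtain ⟨C', h1, h2, h3⟩ := h ι _ f hf C hB hC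
  refine ⟨0, fun _ => C', fun _ => ⟨h1, h2⟩, fun x => ?_⟩
  have : (Finset.univ.filter fun ρ : Fin 0 → Bool => C'.eval x ≠ f x) = ∅ := by
    apply Finset.filter_false_of_mem
    intro ρ _
    simp [h3 x]
  simp [this]

/-- The **level functions** of `f`: `levelFn f w x ↔` some true point of weight exactly `w` lies below `x`
(the up-closure of `f ∩ slice w`; level-generated by construction). -/
noncomputable def levelFn {ι : Type} [Fintype ι] (f : (ι → Bool) → Bool) (w : ℕ) : (ι → Bool) → Bool :=
  fun x => decide (∃ y, y ≤ x ∧ f y = true ∧ weight y = w)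

/-- Every monotone `f` is the OR of its `n+1` level functions (the merge-free form of the Berkowitz seam:
`f = ⋁_w ↑(C_w ∩ slice w)`). [folklore] -/
theorem eq_true_iff_exists_levelFn {ι : Type} [Fintype ι] {f : (ι → Bool) → Bool} (hf : Monotone f)
    (x : ι → Bool) : f x = true ↔ ∃ w, w ≤ Fintype.card ι ∧ levelFn f w x = true := by
  constructor
  · intro hx
    refine ⟨weight x, ?_, ?_⟩
    · exact Finset.card_le_univ _
    · simp only [levelFn, decide_eq_true_eq]
      exact ⟨x, le_rfl, hx, rfl⟩
  · rintro ⟨w, -, hw⟩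
    simp only [levelFn, decide_eq_true_eq] at hw
    obtain ⟨y, hyx, hy, -⟩ := hw
    have := hf hyx
    rw [hy] at this
    exact top_le_iff.1 this

/-- **`LevelCapture` (DECOMPOSITION heading — the OR-split of the seam; TOO STRONG).**  "Every level function of
a monotone P/poly function has a polynomial extended circuit."  With `eq_true_iff_exists_levelFn` it implies
`Capture` by an OR of `n+1` circuits; but it is NOT implied by `Capture`: level functions of monotone CNFs are
`NP`-complete objects (`↑(f ∩ slice w)` for `f` = "the selected sets cover `U`" is SET COVER, TRIAGE-r1-1
App. B), so `LevelCapture` asserts polynomial extended circuits for functions outside `P/poly` (unless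
`NP ⊆ P/poly`).  Recorded so that nobody files the OR-split of the seam as a decomposition. [folklore] -/
def LevelCapture : Prop :=
  ∃ a : ℕ, ∀ (ι : Type) (_ : Fintype ι) (f : (ι → Bool) → Bool), Monotone f →
    ∀ C : Circuit ι, C.IsOver B2 → C.Computes f → ∀ w : ℕ,
      ∃ C' : Circuit ι, C'.IsOver (extGate ((C.size + Fintype.card ι + 2) ^ a)) ∧
        C'.size ≤ (C.size + Fintype.card ι + 2) ^ a ∧ C'.Computes (levelFn f w)

end Summit.PneNP.PneNP.Cruxes.Capture.StrategistR1
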